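import Literature.MathematicalPhysics.QuantumFieldTheory.Balaban1983to89.Node00.HistoryGermReading

/-!
# Node O ∕ W1-16 — KING's ALGEBRA INSIDE THE HISTORY SPACE OF RECORD: complex rows holomorphic along the analytic discs of the cells

[I] §1 p.263 reads every older term `E^{(j)}(X; g₀,…,g_{j−1}; 𝐔, 𝐉)` as «defined and analytic on the space `U^c_j(X, α₀, α₁)`», and [II] produces
the new term from the whole analytic GERM of the history (Cauchy formulas along one-parameter analytic families, (1.22)–(1.24) p.7; Lemma 3
(2.38) p.20).  W1-14 (`HistoryGermReading`) typed the history of the pair of runs (torus `k`, torus `k+1`) as a point of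
`W1.GHist F M N k sp = lp (fun _ : GermIdx … ↦ ℂ) ∞` — ALL bounded complex tables over the germ indices, analytic or not.  The output majorant of
[II] Lemma 3 ∕ King 1986 Thm 3.4 lives on the SLICE of histories whose rows ARE analytic on the cells (King's one sup-normed algebra), not on
the full `lp∞` box.  This file homes that slice in W1's vocabulary:

* `W1.cRow h X` — the COMPLEX ROW of a history `h` at a run-A domain `X`: `ψ ↦ h⟨X,⟨ψ,_⟩,re⟩ + I·h⟨X,⟨ψ,_⟩,im⟩` on the cell
  `W1.cell X := sp (k+1) (πX).1 (πX).2` (run B's table at the paired domain), `0` off it; `W1.analyticRows` — the ℂ-submodule of histories whose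
  rows are ambient-analytic at the points of their cells (W1-13 `FieldAdm` style; NOT closed in `lp∞`).
* `W1.discRows` — the DISC EDITION: rows holomorphic along every analytic disc `γ : 𝔻 → cell X` (`DifferentiableOn ℂ γ 𝔻`, `MapsTo γ 𝔻 (cell X)`
  ⇒ `DifferentiableOn ℂ (cRow h X ∘ γ) 𝔻`).  The cells of record are images of `Gᶜ = SL(N,ℂ)`-valued bond fields, thin in
  `CPair (F.P (k+1)) (MatA N)` (empty interior), so an «interior» edition would be vacuous; the one-parameter families of print ((1.22)–(1.24):
  `ζ ↦ (U·exp(ζA), J)`) are such discs.  `analyticRows ≤ discRows`; ★ `isClosed_discRows` (Mathlib's one-variable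
  `TendstoLocallyUniformlyOn.differentiableOn` — locally uniform limits of holomorphic functions are holomorphic); `discRows` is a ℂ-submodule.
* `W1.DiscHolo T S` — holomorphy of a map ALONG THE ANALYTIC DISCS of a set (the disc form of the configuration transport's analyticity clause;
  implied by ambient analyticity, `discHolo_of_analyticOnNhd`; exactly what composes, `differentiableOn_comp_of_discHolo`).
* THE MEMBERSHIP FACES for W1-14's insertion of record `W1.insOfRecord κ c ω rHist n t`: ★ `insOfRecord_mem_discRows` (bounded weighted table
  + complex germs holomorphic along the discs of the cells), ★ `insOfRecord_tableB_mem_discRows` (run B: ambient-analytic terms on the cells),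
  ★ `insOfRecord_tableA_mem_discRows` (run A: cell-preserving transport `Tcfg (cell X) ⊆ sp k X.1 X.2`, disc-holomorphic transport, ambient-analytic
  run-A terms on THEIR cells); and the discharges from W1-13's classes — `weightTable_mem_bddTables_of_decay` (the (1.18)∕(1.26) decay with the
  weight's rate `κ` bounds the weighted table by `c·(max 1 ω)ⁿ·|rHist n|·E₀`), `insOfRecord_tableB_mem_discRows_of_adm`,
  `insOfRecord_tableA_mem_discRows_of_adm` (`SizeAdm` + `FieldAdm` of the runs' terms at every `g ∈ W` and every truncation level, the hypothesis
  shape of W1-14's `decayBound_EBgerm_of_sizeAdm` ∕ `decayBound_EAgerm_of_sizeAdm`, + the transport's table clause `hTsp` + `DiscHolo Tcfg`).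

HONESTY.  Definitions, one closedness lemma and membership bookkeeping; every analyticity ∕ transport clause is a displayed HYPOTHESIS read where
used; nothing of Bałaban's Lemma 3 or King's Thm 3.4 is asserted; node N18 ∕ N22 are NOT discharged here; count-neutral.  The configuration
transport `Tcfg` stays a PARAMETER (W1-14's honesty note applies verbatim).  Not homed here: the anchored quasi-retraction ∕ `retract` ∕ `slice`
algebra over `T4InputCauchyRateData.StepModel` (generic END-schema algebra; its home is beside `StepModel`).
CREDIT.  Statements and proofs of `cRow` … `insOfRecord_tableA_mem_discRows` are the W1-vocabulary re-homing of the lens seat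
ym-lens-BalabanUVNodes-transfer (g26) sketch `LensTransferSketch26.lean` §5–§7 (sha16 f7b2fec85acb7949), which is not importable by tree files.
No type-class declarations, custom syntax or attribute changes are introduced (typer lint); the matrix norm scope is Mathlib's
`Matrix.Norms.L2Operator`, as in `Record11`.

References: [I] = T. Balaban, Commun. Math. Phys. 109 (1987) 249–301 (`Balaban1987RG1`); [II] = T. Balaban, Commun. Math. Phys. 116 (1988)
1–22 (`Balaban1988RG2Cluster`); C. King, Commun. Math. Phys. 103 (1986) 323–349, Thm 3.4 (the sup-normed algebra of analytic activities).
-/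

noncomputable section

open Metric Set Filter
open scoped Matrix.Norms.L2Operator

namespace Literature.MathematicalPhysics.QuantumFieldTheory.Balaban1983to89.Node00

open Literature.MathematicalPhysics.QuantumFieldTheory.Balaban1983to89
open TreeLengthTorus T4Continuum Sect2
open Literature.MathematicalPhysics.QuantumFieldTheory.Balaban1983to89.T4OutputRate (Carriers Functional DecayBound)
open Literature.MathematicalPhysics.QuantumFieldTheory.Balaban1983to89.T4InputCauchyRateData (StepModel tableA tableB)
open scoped ENNReal

namespace W1

variable (F : T4Family) (M N : ℕ) (k : ℕ)
variable (sp : (k j : ℕ) → (domSys (F.P k) M j).Dom → Set (CPair (F.P k) (MatA N)))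

/-! ## The complex rows of a history and the ambient-analytic row submodule -/

section Rows

/-- the CELL of a run-A domain `X`: run B's analyticity table at the paired domain `πX` (a set of configurations of the `(k+1)`-th torus).
[cite: Balaban1987RG1, §1 p.263 (the spaces U^c_j(X, α₀, α₁)); Balaban1988RG2Cluster, (2.14) p.15] -/
abbrev cell (X : W1.Dom (F.P k) M) : Set (CPair (F.P (k + 1)) (MatA N)) :=
  sp (k + 1) (pairOfRecord F M k X).1 (pairOfRecord F M k X).2

open scoped Classical in
/-- **THE COMPLEX ROW** of a history `h` at a run-A domain `X`: `ψ ↦ h⟨X,⟨ψ,_⟩,re⟩ + I·h⟨X,⟨ψ,_⟩,im⟩` on the cell, `0` off it.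
[cite: Balaban1987RG1, §1 p.263 («E^{(j)} … defined and analytic on the space U^c_j»)] -/
def cRow (h : GHist F M N k sp) (X : W1.Dom (F.P k) M) : CPair (F.P (k + 1)) (MatA N) → ℂ :=
  fun φ => if hφ : φ ∈ sp (k + 1) (pairOfRecord F M k X).1 (pairOfRecord F M k X).2 then
    (h : GermIdx F M N k sp → ℂ) ⟨X, ⟨φ, hφ⟩, true⟩ + Complex.I * (h : GermIdx F M N k sp → ℂ) ⟨X, ⟨φ, hφ⟩, false⟩ else 0

/-- Face: additivity of the row. [cite: Balaban1987RG1, §1 p.263 (bookkeeping)] -/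
theorem cRow_add (h h' : GHist F M N k sp) (X : W1.Dom (F.P k) M) : cRow F M N k sp (h + h') X = cRow F M N k sp h X + cRow F M N k sp h' X := by
  funext φ
  by_cases hφ : φ ∈ sp (k + 1) (pairOfRecord F M k X).1 (pairOfRecord F M k X).2
  · simp only [cRow, dif_pos hφ, lp.coeFn_add, Pi.add_apply]
    ring
  · simp only [cRow, dif_neg hφ, Pi.add_apply, add_zero]

/-- Face: complex homogeneity of the row. [cite: Balaban1987RG1, §1 p.263 (bookkeeping)] -/
theorem cRow_smul (a : ℂ) (h : GHist F M N k sp) (X : W1.Dom (F.P k) M) : cRow F M N k sp (a • h) X = a • cRow F M N k sp h X := by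
  funext φ
  by_cases hφ : φ ∈ sp (k + 1) (pairOfRecord F M k X).1 (pairOfRecord F M k X).2
  · simp only [cRow, dif_pos hφ, lp.coeFn_smul, Pi.smul_apply, smul_eq_mul]
    ring
  · simp only [cRow, dif_neg hφ, Pi.smul_apply, smul_eq_mul, mul_zero]

/-- Face: the zero history has zero rows. [cite: Balaban1987RG1, §1 p.263 (bookkeeping)] -/
theorem cRow_zero (X : W1.Dom (F.P k) M) : cRow F M N k sp 0 X = 0 := by
  funext φ
  by_cases hφ : φ ∈ sp (k + 1) (pairOfRecord F M k X).1 (pairOfRecord F M k X).2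
  · simp only [cRow, dif_pos hφ, lp.coeFn_zero]
    change (0 : ℂ) + Complex.I * 0 = 0
    simp
  · simp only [cRow, dif_neg hφ, Pi.zero_apply]

/-- Face: the row of a difference. [cite: Balaban1987RG1, §1 p.263 (bookkeeping)] -/
theorem cRow_sub (h h' : GHist F M N k sp) (X : W1.Dom (F.P k) M) : cRow F M N k sp (h - h') X = cRow F M N k sp h X - cRow F M N k sp h' X := by
  funext φ
  by_cases hφ : φ ∈ sp (k + 1) (pairOfRecord F M k X).1 (pairOfRecord F M k X).2
  · simp only [cRow, dif_pos hφ, lp.coeFn_sub, Pi.sub_apply]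
    ring
  · simp only [cRow, dif_neg hφ, Pi.sub_apply, sub_zero]

/-- the `lp∞` norm dominates every complex row pointwise (factor `2`: real + imaginary slot). [cite: Balaban1987RG1, (1.18) p.263 (bookkeeping)] -/
theorem norm_cRow_le (h : GHist F M N k sp) (X : W1.Dom (F.P k) M) (φ : CPair (F.P (k + 1)) (MatA N)) : ‖cRow F M N k sp h X φ‖ ≤ 2 * ‖h‖ := by
  by_cases hφ : φ ∈ sp (k + 1) (pairOfRecord F M k X).1 (pairOfRecord F M k X).2
  · simp only [cRow, dif_pos hφ]
    have h1 := lp.norm_apply_le_norm ENNReal.top_ne_zero h ⟨X, ⟨φ, hφ⟩, true⟩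
    have h2 := lp.norm_apply_le_norm ENNReal.top_ne_zero h ⟨X, ⟨φ, hφ⟩, false⟩
    calc ‖(h : GermIdx F M N k sp → ℂ) ⟨X, ⟨φ, hφ⟩, true⟩ + Complex.I * (h : GermIdx F M N k sp → ℂ) ⟨X, ⟨φ, hφ⟩, false⟩‖
        ≤ ‖(h : GermIdx F M N k sp → ℂ) ⟨X, ⟨φ, hφ⟩, true⟩‖ + ‖Complex.I * (h : GermIdx F M N k sp → ℂ) ⟨X, ⟨φ, hφ⟩, false⟩‖ :=
          norm_add_le _ _
      _ ≤ ‖h‖ + ‖h‖ := by rw [norm_mul, Complex.norm_I, one_mul]; exact add_le_add h1 h2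
      _ = 2 * ‖h‖ := by ring
  · simp only [cRow, dif_neg hφ, norm_zero]
    positivity

/-- **THE AMBIENT-ANALYTIC ROW SUBMODULE** of the history space: histories whose complex rows are analytic near every point of their cells
(W1-13 `FieldAdm` style `AnalyticOnNhd ℂ · (sp …)`; a ℂ-submodule, NOT closed in `lp∞`). [cite: Balaban1987RG1, §1 p.263 (clause before (1.18))] -/
def analyticRows : Submodule ℂ (GHist F M N k sp) where
  carrier := {h | ∀ X : W1.Dom (F.P k) M, AnalyticOnNhd ℂ (cRow F M N k sp h X) (sp (k + 1) (pairOfRecord F M k X).1 (pairOfRecord F M k X).2)}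
  add_mem' := by
    intro h h' hh hh' X
    rw [cRow_add]
    exact (hh X).add (hh' X)
  zero_mem' := by
    intro X
    rw [cRow_zero]
    exact analyticOnNhd_const
  smul_mem' := by
    intro a h hh X
    rw [cRow_smul]
    exact (analyticOnNhd_const (v := a)).smul (hh X)

/-- Face: membership in the ambient-analytic row submodule, displayed. [cite: Balaban1987RG1, §1 p.263 (clause before (1.18))] -/
theorem mem_analyticRows_iff (h : GHist F M N k sp) :
    h ∈ analyticRows F M N k sp ↔
      ∀ X : W1.Dom (F.P k) M, AnalyticOnNhd ℂ (cRow F M N k sp h X) (sp (k + 1) (pairOfRecord F M k X).1 (pairOfRecord F M k X).2) :=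
  Iff.rfl

end Rows

/-! ## The disc edition: rows holomorphic along every analytic disc of the cell — a CLOSED ℂ-submodule of the history space -/

section DiscRows

/-- the complex row read along a map `γ : ℂ → Φ` (an analytic disc of the cell when `γ` is holomorphic on `𝔻` with values in the cell).
[cite: Balaban1988RG2Cluster, (1.22)-(1.24) p.7 (one-parameter analytic families of configurations)] -/
def discRow (h : GHist F M N k sp) (X : W1.Dom (F.P k) M) (γ : ℂ → CPair (F.P (k + 1)) (MatA N)) : ℂ → ℂ :=
  fun ζ => cRow F M N k sp h X (γ ζ)

/-- Face: additivity along a disc. [cite: Balaban1988RG2Cluster, (1.22)-(1.24) p.7 (bookkeeping)] -/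
theorem discRow_add (h h' : GHist F M N k sp) (X : W1.Dom (F.P k) M) (γ : ℂ → CPair (F.P (k + 1)) (MatA N)) :
    discRow F M N k sp (h + h') X γ = discRow F M N k sp h X γ + discRow F M N k sp h' X γ := by
  funext ζ; simp only [discRow, cRow_add, Pi.add_apply]

/-- Face: subtraction along a disc. [cite: Balaban1988RG2Cluster, (1.22)-(1.24) p.7 (bookkeeping)] -/
theorem discRow_sub (h h' : GHist F M N k sp) (X : W1.Dom (F.P k) M) (γ : ℂ → CPair (F.P (k + 1)) (MatA N)) :
    discRow F M N k sp (h - h') X γ = discRow F M N k sp h X γ - discRow F M N k sp h' X γ := by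
  funext ζ; simp only [discRow, cRow_sub, Pi.sub_apply]

/-- Face: complex homogeneity along a disc. [cite: Balaban1988RG2Cluster, (1.22)-(1.24) p.7 (bookkeeping)] -/
theorem discRow_smul (a : ℂ) (h : GHist F M N k sp) (X : W1.Dom (F.P k) M) (γ : ℂ → CPair (F.P (k + 1)) (MatA N)) :
    discRow F M N k sp (a • h) X γ = fun ζ => a • discRow F M N k sp h X γ ζ := by
  funext ζ; simp only [discRow, cRow_smul, Pi.smul_apply]

/-- Face: the zero history along a disc. [cite: Balaban1988RG2Cluster, (1.22)-(1.24) p.7 (bookkeeping)] -/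
theorem discRow_zero (X : W1.Dom (F.P k) M) (γ : ℂ → CPair (F.P (k + 1)) (MatA N)) : discRow F M N k sp 0 X γ = fun _ => 0 := by
  funext ζ; simp only [discRow, cRow_zero, Pi.zero_apply]

/-- **KING's ALGEBRA INSIDE THE HISTORY SPACE, DISC EDITION**: histories whose complex rows are holomorphic along every analytic disc of their
cells (`γ : 𝔻 → cell X` holomorphic ⇒ `cRow h X ∘ γ` holomorphic on `𝔻`). [cite: Balaban1987RG1, §1 p.263 (analyticity on U^c_j); Balaban1988RG2Cluster, (1.22)-(1.24) p.7, Lemma 3 (2.38) p.20] -/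
def discRows : Submodule ℂ (GHist F M N k sp) where
  carrier := {h | ∀ (X : W1.Dom (F.P k) M) (γ : ℂ → CPair (F.P (k + 1)) (MatA N)),
    DifferentiableOn ℂ γ (ball (0 : ℂ) 1) → MapsTo γ (ball (0 : ℂ) 1) (cell F M N k sp X) →
      DifferentiableOn ℂ (discRow F M N k sp h X γ) (ball (0 : ℂ) 1)}
  add_mem' := by
    intro h h' hh hh' X γ hγ hγc
    rw [discRow_add]
    exact (hh X γ hγ hγc).add (hh' X γ hγ hγc)
  zero_mem' := by
    intro X γ _ _
    rw [discRow_zero]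
    exact differentiableOn_const 0
  smul_mem' := by
    intro a h hh X γ hγ hγc
    rw [discRow_smul]
    exact (hh X γ hγ hγc).const_smul a

/-- Face: membership in the disc edition, displayed. [cite: Balaban1988RG2Cluster, (1.22)-(1.24) p.7] -/
theorem mem_discRows_iff (h : GHist F M N k sp) :
    h ∈ discRows F M N k sp ↔ ∀ (X : W1.Dom (F.P k) M) (γ : ℂ → CPair (F.P (k + 1)) (MatA N)),
      DifferentiableOn ℂ γ (ball (0 : ℂ) 1) → MapsTo γ (ball (0 : ℂ) 1) (cell F M N k sp X) →
        DifferentiableOn ℂ (discRow F M N k sp h X γ) (ball (0 : ℂ) 1) :=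
  Iff.rfl

/-- `analyticRows ≤ discRows`: ambient-analytic near every point of the cell ⇒ holomorphic along every analytic disc of the cell.
[cite: Balaban1987RG1, §1 p.263 (clause before (1.18))] -/
theorem analyticRows_le_discRows : analyticRows F M N k sp ≤ discRows F M N k sp := by
  intro h hh X γ hγ hγc ζ hζ
  have hA : AnalyticAt ℂ (cRow F M N k sp h X) (γ ζ) := hh X (γ ζ) (hγc hζ)
  have hγζ : DifferentiableAt ℂ γ ζ := (hγ ζ hζ).differentiableAt (isOpen_ball.mem_nhds hζ)
  exact (hA.differentiableAt.comp ζ hγζ).differentiableWithinAt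

/-- uniform control of a disc row by the `lp∞` distance. [cite: Balaban1987RG1, (1.18) p.263 (bookkeeping)] -/
theorem dist_discRow_le (h h' : GHist F M N k sp) (X : W1.Dom (F.P k) M) (γ : ℂ → CPair (F.P (k + 1)) (MatA N)) (ζ : ℂ) :
    dist (discRow F M N k sp h X γ ζ) (discRow F M N k sp h' X γ ζ) ≤ 2 * dist h h' := by
  rw [dist_eq_norm, dist_eq_norm, ← Pi.sub_apply, ← discRow_sub]
  exact norm_cRow_le F M N k sp (h - h') X (γ ζ)

/-- ★ **THE DISC EDITION IS CLOSED** in the history space: one-variable locally uniform limits of holomorphic functions are holomorphic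
(Mathlib `TendstoLocallyUniformlyOn.differentiableOn`), and `lp∞` convergence is uniform along every disc (`dist_discRow_le`).
[cite: Balaban1988RG2Cluster, Lemma 3 (2.38) p.20 (the sup-normed space of analytic activities); Balaban1987RG1, §1 p.263] -/
theorem isClosed_discRows : IsClosed (discRows F M N k sp : Set (GHist F M N k sp)) := by
  refine isSeqClosed_iff_isClosed.mp fun u h hu hlim => ?_
  intro X γ hγ hγc
  have hunif : TendstoUniformly (fun m => discRow F M N k sp (u m) X γ) (discRow F M N k sp h X γ) atTop := by
    rw [Metric.tendstoUniformly_iff]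
    intro ε hε
    obtain ⟨N₀, hN₀⟩ := Metric.tendsto_atTop.mp hlim (ε / 4) (by positivity)
    refine eventually_atTop.mpr ⟨N₀, fun m hm ζ => ?_⟩
    have h1 := dist_discRow_le F M N k sp h (u m) X γ ζ
    have h2 : dist h (u m) < ε / 4 := by rw [dist_comm]; exact hN₀ m hm
    linarith
  exact (hunif.tendstoUniformlyOn (s := ball (0 : ℂ) 1)).tendstoLocallyUniformlyOn.differentiableOn
    (Eventually.of_forall fun m => hu m X γ hγ hγc) isOpen_ball

end DiscRows

/-! ## Holomorphy along discs of a transport; the membership faces of the insertion of record -/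

section Membership

/-- **HOLOMORPHY OF A MAP ALONG THE ANALYTIC DISCS OF A SET** (the disc form of the analyticity clause of a configuration transport).
[cite: Balaban1988RG2Cluster, (1.41) p.11 (the previous-torus terms read on the new torus' fields), (1.22)-(1.24) p.7] -/
def DiscHolo {E₁ E₂ : Type*} [NormedAddCommGroup E₁] [NormedSpace ℂ E₁] [NormedAddCommGroup E₂] [NormedSpace ℂ E₂]
    (T : E₁ → E₂) (S : Set E₁) : Prop :=
  ∀ γ : ℂ → E₁, DifferentiableOn ℂ γ (ball (0 : ℂ) 1) → MapsTo γ (ball (0 : ℂ) 1) S → DifferentiableOn ℂ (fun ζ => T (γ ζ)) (ball (0 : ℂ) 1)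

/-- ambient analyticity at the points of `S` gives holomorphy along the discs of `S`. [cite: Balaban1988RG2Cluster, (1.41) p.11 (bookkeeping)] -/
theorem discHolo_of_analyticOnNhd {E₁ E₂ : Type*} [NormedAddCommGroup E₁] [NormedSpace ℂ E₁] [NormedAddCommGroup E₂] [NormedSpace ℂ E₂]
    [CompleteSpace E₂] {T : E₁ → E₂} {S : Set E₁} (hT : AnalyticOnNhd ℂ T S) : DiscHolo T S := by
  intro γ hγ hγS ζ hζ
  exact ((hT (γ ζ) (hγS hζ)).differentiableAt.comp ζ ((hγ ζ hζ).differentiableAt (isOpen_ball.mem_nhds hζ))).differentiableWithinAt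

/-- composition: a disc-holomorphic, set-preserving transport followed by an ambient-analytic scalar function is holomorphic along discs.
[cite: Balaban1988RG2Cluster, (1.41) p.11 (bookkeeping)] -/
theorem differentiableOn_comp_of_discHolo {E₁ E₂ : Type*} [NormedAddCommGroup E₁] [NormedSpace ℂ E₁] [NormedAddCommGroup E₂]
    [NormedSpace ℂ E₂] {T : E₁ → E₂} {S₁ : Set E₁} {S₂ : Set E₂} {f : E₂ → ℂ} (hT : DiscHolo T S₁) (hTS : MapsTo T S₁ S₂)
    (hf : AnalyticOnNhd ℂ f S₂) (γ : ℂ → E₁) (hγ : DifferentiableOn ℂ γ (ball (0 : ℂ) 1)) (hγS : MapsTo γ (ball (0 : ℂ) 1) S₁) :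
    DifferentiableOn ℂ (fun ζ => f (T (γ ζ))) (ball (0 : ℂ) 1) := by
  intro ζ hζ
  have h1 : DifferentiableAt ℂ (fun ζ => T (γ ζ)) ζ := (hT γ hγ hγS ζ hζ).differentiableAt (isOpen_ball.mem_nhds hζ)
  exact ((hf (T (γ ζ)) (hTS (hγS hζ))).differentiableAt.comp ζ h1).differentiableWithinAt

/-- the insertion weight of W1-14 depends on the germ index only through its run-A domain. [cite: Balaban1988RG2Cluster, (1.24) p.7 (bookkeeping)] -/
def domWeight (κ c ω : ℝ) (rHist : ℕ → ℝ) (n : ℕ) (X : W1.Dom (F.P k) M) : ℝ :=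
  if X.1 < n then c * ω ^ (n - 1 - X.1) * rHist n * Real.exp (κ * (domSys (F.P k) M X.1).dj X.2) else 0

/-- Face (`rfl`). [cite: Balaban1988RG2Cluster, (1.24) p.7 (bookkeeping)] -/
theorem insWeight_eq_domWeight (κ c ω : ℝ) (rHist : ℕ → ℝ) (n : ℕ) (i : GermIdx F M N k sp) :
    insWeight F M N k sp κ c ω rHist n i = domWeight F M k κ c ω rHist n i.1 := rfl

/-- ★ **GENERIC MEMBERSHIP**: bounded weighted table + complex germs holomorphic along the discs of the cells ⇒ the inserted history lies in the
disc edition. [cite: Balaban1988RG2Cluster, (1.33) p.9 and (1.41) p.11 (the history enters through the older terms' germs); Balaban1987RG1, §1 p.263] -/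
theorem insOfRecord_mem_discRows (κ c ω : ℝ) (rHist : ℕ → ℝ) (n : ℕ) (t : GermIdx F M N k sp → ℝ)
    (hbdd : weightTable F M N k sp κ c ω rHist n t ∈ GermHist.bddTables (GermIdx F M N k sp))
    (hgerm : ∀ X : W1.Dom (F.P k) M, ∃ E : CPair (F.P (k + 1)) (MatA N) → ℂ,
      (∀ γ : ℂ → CPair (F.P (k + 1)) (MatA N), DifferentiableOn ℂ γ (ball (0 : ℂ) 1) → MapsTo γ (ball (0 : ℂ) 1) (cell F M N k sp X) →
          DifferentiableOn ℂ (fun ζ => E (γ ζ)) (ball (0 : ℂ) 1)) ∧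
        ∀ (ψ : CPair (F.P (k + 1)) (MatA N)) (hψ : ψ ∈ cell F M N k sp X),
          ((t ⟨X, ⟨ψ, hψ⟩, true⟩ : ℝ) : ℂ) + Complex.I * ((t ⟨X, ⟨ψ, hψ⟩, false⟩ : ℝ) : ℂ) = E ψ) :
    insOfRecord F M N k sp κ c ω rHist n t ∈ discRows F M N k sp := by
  intro X γ hγ hγc
  obtain ⟨E, hE, htE⟩ := hgerm X
  have key : ∀ ζ ∈ ball (0 : ℂ) 1, discRow F M N k sp (insOfRecord F M N k sp κ c ω rHist n t) X γ ζ =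
      ((domWeight F M k κ c ω rHist n X : ℝ) : ℂ) * E (γ ζ) := by
    intro ζ hζ
    have hm : γ ζ ∈ cell F M N k sp X := hγc hζ
    simp only [discRow, cRow, dif_pos hm, insOfRecord]
    rw [GermHist.embAll_apply_of_mem _ _ hbdd, GermHist.embAll_apply_of_mem _ _ hbdd]
    simp only [weightTable, insWeight_eq_domWeight]
    rw [← htE (γ ζ) hm]
    push_cast
    ring
  exact ((differentiableOn_const ((domWeight F M k κ c ω rHist n X : ℝ) : ℂ)).mul (hE γ hγ hγc)).congr key

/-- ★ **RUN B's MEMBERSHIP**: the inserted germ table of `E_B` lies in the disc edition when its weighted table is bounded and every run-B term is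
ambient-analytic on its cell. [cite: Balaban1987RG1, §1 p.263 (clause before (1.18)); Balaban1988RG2Cluster, (2.13)-(2.14) pp.14-15] -/
theorem insOfRecord_tableB_mem_discRows (κ c ω : ℝ) (rHist : ℕ → ℝ) (n : ℕ) (S' : ClusterTower (F.P (k + 1)) (MatA N) M) (b : ℝ)
    (g : ℕ → ℝ) (U : Unit)
    (hbdd : weightTable F M N k sp κ c ω rHist n (tableB (C := germCarriers F M N k sp) (EBgerm F M N k sp S' b) g U) ∈
      GermHist.bddTables (GermIdx F M N k sp))
    (hfield : ∀ X : W1.Dom (F.P k) M, AnalyticOnNhd ℂ (fun ψ => functionalC S' (prependCoupling b g) ψ (pairOfRecord F M k X)) (cell F M N k sp X)) :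
    insOfRecord F M N k sp κ c ω rHist n (tableB (C := germCarriers F M N k sp) (EBgerm F M N k sp S' b) g U) ∈ discRows F M N k sp := by
  refine insOfRecord_mem_discRows F M N k sp κ c ω rHist n _ hbdd fun X =>
    ⟨fun ψ => functionalC S' (prependCoupling b g) ψ (pairOfRecord F M k X), ?_, ?_⟩
  · intro γ hγ hγc ζ hζ
    exact (((hfield X) (γ ζ) (hγc hζ)).differentiableAt.comp ζ ((hγ ζ hζ).differentiableAt (isOpen_ball.mem_nhds hζ))).differentiableWithinAt
  · intro ψ hψ
    simp only [tableB, EBgerm, reIm_true, reIm_false]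
    rw [mul_comm]
    exact Complex.re_add_im _

/-- ★ **RUN A's MEMBERSHIP**: the inserted germ table of `E_A ∘ Tcfg` lies in the disc edition when its weighted table is bounded, the transport maps
each cell into run A's table at the domain and is holomorphic along the discs of the cell, and every run-A term is ambient-analytic on ITS cell.
[cite: Balaban1988RG2Cluster, (1.41) p.11, (2.13)-(2.14) pp.14-15; Balaban1987RG1, §1 p.263 (clause before (1.18))] -/
theorem insOfRecord_tableA_mem_discRows (κ c ω : ℝ) (rHist : ℕ → ℝ) (n : ℕ) (S : ClusterTower (F.P k) (MatA N) M)
    (Tcfg : CPair (F.P (k + 1)) (MatA N) → CPair (F.P k) (MatA N)) (g : ℕ → ℝ) (U : Unit)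
    (hbdd : weightTable F M N k sp κ c ω rHist n (tableA (C := germCarriers F M N k sp) (EAgerm F M N k sp S Tcfg) g U) ∈
      GermHist.bddTables (GermIdx F M N k sp))
    (hc2 : ∀ X : W1.Dom (F.P k) M, MapsTo Tcfg (cell F M N k sp X) (sp k X.1 X.2))
    (hc3D : ∀ X : W1.Dom (F.P k) M, DiscHolo Tcfg (cell F M N k sp X))
    (hfield : ∀ X : W1.Dom (F.P k) M, AnalyticOnNhd ℂ (fun φ => functionalC S g φ X) (sp k X.1 X.2)) :
    insOfRecord F M N k sp κ c ω rHist n (tableA (C := germCarriers F M N k sp) (EAgerm F M N k sp S Tcfg) g U) ∈ discRows F M N k sp := by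
  refine insOfRecord_mem_discRows F M N k sp κ c ω rHist n _ hbdd fun X => ⟨fun ψ => functionalC S g (Tcfg ψ) X, ?_, ?_⟩
  · intro γ hγ hγc
    exact differentiableOn_comp_of_discHolo (hc3D X) (hc2 X) (hfield X) γ hγ hγc
  · intro ψ hψ
    simp only [tableA, EAgerm, reIm_true, reIm_false]
    rw [mul_comm]
    exact Complex.re_add_im _

/-! ### Discharging the two hypotheses from W1-13's classes (`SizeAdm`, `FieldAdm`) and the transport's table clause -/

/-- **THE (1.18)∕(1.26) DECAY WITH THE WEIGHT's RATE BOUNDS THE WEIGHTED TABLE**: if `|t i| ≤ E₀ e^{−κ d_j(X)}` at every germ index, then the step-`n`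
weighted table of W1-14 is a bounded table, with the bound `c·(max 1 ω)ⁿ·|rHist n|·E₀` (the weight `c ω^{n−1−j} rHist n e^{κ d}` is normalised exactly
against the decay). [cite: Balaban1988RG2Cluster, (1.24) p.7, (1.26) p.8; Balaban1987RG1, (1.18) p.263] -/
theorem weightTable_mem_bddTables_of_decay (κ c ω : ℝ) (rHist : ℕ → ℝ) (n : ℕ) (hc : 0 ≤ c) (hω : 0 ≤ ω) (E₀ : ℝ)
    (t : GermIdx F M N k sp → ℝ) (ht : ∀ i : GermIdx F M N k sp, |t i| ≤ E₀ * Real.exp (-(κ * (domSys (F.P k) M i.1.1).dj i.1.2))) :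
    weightTable F M N k sp κ c ω rHist n t ∈ GermHist.bddTables (GermIdx F M N k sp) := by
  refine GermHist.mem_bddTables_of_bound _ _ (c * max 1 ω ^ n * |rHist n| * E₀) fun i => ?_
  have hti := ht i
  have hE₀ : 0 ≤ E₀ := nonneg_of_mul_nonneg_left ((abs_nonneg (t i)).trans hti) (Real.exp_pos _)
  have hB : 0 ≤ c * max 1 ω ^ n * |rHist n| * E₀ := by positivity
  by_cases hi : i.1.1 < n
  · have hpow : ω ^ (n - 1 - i.1.1) ≤ max 1 ω ^ n :=
      (pow_le_pow_left₀ hω (le_max_right 1 ω) _).trans (pow_le_pow_right₀ (le_max_left 1 ω) (by omega))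
    have hw : weightTable F M N k sp κ c ω rHist n t i =
        c * ω ^ (n - 1 - i.1.1) * rHist n * Real.exp (κ * (domSys (F.P k) M i.1.1).dj i.1.2) * t i := by
      simp [weightTable, insWeight, hi]
    have hexp : Real.exp (κ * (domSys (F.P k) M i.1.1).dj i.1.2) * Real.exp (-(κ * (domSys (F.P k) M i.1.1).dj i.1.2)) = 1 := by
      rw [← Real.exp_add, add_neg_cancel, Real.exp_zero]
    rw [hw, abs_mul, abs_mul, abs_mul, abs_mul, abs_of_nonneg hc, abs_of_nonneg (pow_nonneg hω _), abs_of_nonneg (Real.exp_pos _).le]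
    calc c * ω ^ (n - 1 - i.1.1) * |rHist n| * Real.exp (κ * (domSys (F.P k) M i.1.1).dj i.1.2) * |t i|
        ≤ c * ω ^ (n - 1 - i.1.1) * |rHist n| * Real.exp (κ * (domSys (F.P k) M i.1.1).dj i.1.2) *
            (E₀ * Real.exp (-(κ * (domSys (F.P k) M i.1.1).dj i.1.2))) :=
          mul_le_mul_of_nonneg_left hti (by positivity)
      _ = c * ω ^ (n - 1 - i.1.1) * |rHist n| * E₀ *
            (Real.exp (κ * (domSys (F.P k) M i.1.1).dj i.1.2) * Real.exp (-(κ * (domSys (F.P k) M i.1.1).dj i.1.2))) := by ring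
      _ = c * ω ^ (n - 1 - i.1.1) * |rHist n| * E₀ := by rw [hexp, mul_one]
      _ ≤ c * max 1 ω ^ n * |rHist n| * E₀ := by
          have h1 : 0 ≤ |rHist n| * E₀ := by positivity
          nlinarith [mul_le_mul_of_nonneg_left hpow hc]
  · have h0 : weightTable F M N k sp κ c ω rHist n t i = 0 := by simp [weightTable, insWeight, hi]
    rw [h0, abs_zero]
    exact hB

/-- **RUN B's MEMBERSHIP FROM W1-13's CLASSES**: if at every history `b∷g`, `g ∈ W`, and every truncation level `K` run B's terms lie in the size class
`SizeAdm (sp (k+1)) E₀ κ K` (rate = the weight's `κ`) and in the field-analyticity class `FieldAdm (sp (k+1)) K`, then for `g ∈ W` the inserted run-B germ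
table lies in the disc edition (`0 ≤ c`, `0 ≤ ω`). [cite: Balaban1987RG1, §1 p.263 ((1.18) and the clause before it); Balaban1988RG2Cluster, (2.13)-(2.14) pp.14-15, (1.24) p.7] -/
theorem insOfRecord_tableB_mem_discRows_of_adm (κ c ω : ℝ) (rHist : ℕ → ℝ) (n : ℕ) (hc : 0 ≤ c) (hω : 0 ≤ ω)
    (S' : ClusterTower (F.P (k + 1)) (MatA N) M) (b : ℝ) (W : Set (ℕ → ℝ)) (E₀ : ℝ)
    (hsize : ∀ g ∈ W, ∀ K : ℕ, (fun (j : Fin (K + 1)) Y ψ => termC S' j Y (prependCoupling b g) ψ) ∈ SizeAdm (sp (k + 1)) E₀ κ K)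
    (hfield : ∀ g ∈ W, ∀ K : ℕ, (fun (j : Fin (K + 1)) Y ψ => termC S' j Y (prependCoupling b g) ψ) ∈ FieldAdm (sp (k + 1)) K)
    (g : ℕ → ℝ) (hg : g ∈ W) (U : Unit) :
    insOfRecord F M N k sp κ c ω rHist n (tableB (C := germCarriers F M N k sp) (EBgerm F M N k sp S' b) g U) ∈ discRows F M N k sp := by
  refine insOfRecord_tableB_mem_discRows F M N k sp κ c ω rHist n S' b g U ?_ ?_
  · refine weightTable_mem_bddTables_of_decay F M N k sp κ c ω rHist n hc hω E₀ _ fun i => ?_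
    simpa [tableB] using decayBound_EBgerm_of_sizeAdm (F := F) (M := M) (N := N) (k := k) (sp := sp) S' b W E₀ κ hsize g hg U i
  · intro X
    exact hfield g hg (pairOfRecord F M k X).1 (Fin.last _) (pairOfRecord F M k X).2

/-- **RUN A's MEMBERSHIP FROM W1-13's CLASSES AND THE TRANSPORT's CLAUSES**: if the configuration transport maps run B's table at the paired domain into
run A's table at the domain (W1-14's `hTsp`) and is holomorphic along the discs of every cell, and run A's terms lie in `SizeAdm (sp k) E₀ κ K` and
`FieldAdm (sp k) K` at every `g ∈ W` and `K`, then for `g ∈ W` the inserted run-A germ table lies in the disc edition (`0 ≤ c`, `0 ≤ ω`).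
[cite: Balaban1987RG1, §1 p.263 ((1.18) and the clause before it); Balaban1988RG2Cluster, (1.41) p.11, (2.13)-(2.14) pp.14-15, (1.24) p.7] -/
theorem insOfRecord_tableA_mem_discRows_of_adm (κ c ω : ℝ) (rHist : ℕ → ℝ) (n : ℕ) (hc : 0 ≤ c) (hω : 0 ≤ ω)
    (S : ClusterTower (F.P k) (MatA N) M) (Tcfg : CPair (F.P (k + 1)) (MatA N) → CPair (F.P k) (MatA N))
    (hTsp : ∀ (X : W1.Dom (F.P k) M) (ψ : CPair (F.P (k + 1)) (MatA N)),
      ψ ∈ sp (k + 1) (pairOfRecord F M k X).1 (pairOfRecord F M k X).2 → Tcfg ψ ∈ sp k X.1 X.2)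
    (hc3D : ∀ X : W1.Dom (F.P k) M, DiscHolo Tcfg (cell F M N k sp X))
    (W : Set (ℕ → ℝ)) (E₀ : ℝ)
    (hsize : ∀ g ∈ W, ∀ K : ℕ, (fun (j : Fin (K + 1)) Y ψ => termC S j Y g ψ) ∈ SizeAdm (sp k) E₀ κ K)
    (hfield : ∀ g ∈ W, ∀ K : ℕ, (fun (j : Fin (K + 1)) Y ψ => termC S j Y g ψ) ∈ FieldAdm (sp k) K)
    (g : ℕ → ℝ) (hg : g ∈ W) (U : Unit) :
    insOfRecord F M N k sp κ c ω rHist n (tableA (C := germCarriers F M N k sp) (EAgerm F M N k sp S Tcfg) g U) ∈ discRows F M N k sp := by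
  refine insOfRecord_tableA_mem_discRows F M N k sp κ c ω rHist n S Tcfg g U ?_ (fun X ψ hψ => hTsp X ψ hψ) hc3D ?_
  · refine weightTable_mem_bddTables_of_decay F M N k sp κ c ω rHist n hc hω E₀ _ fun i => ?_
    simpa [tableA] using decayBound_EAgerm_of_sizeAdm (F := F) (M := M) (N := N) (k := k) (sp := sp) S Tcfg hTsp W E₀ κ hsize g hg U i
  · intro X
    exact hfield g hg X.1 (Fin.last _) X.2

end Membership

end W1

end Literature.MathematicalPhysics.QuantumFieldTheory.Balaban1983to89.Node00
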